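import Summits.ResolutionOfSingularities.ResolutionOfSingularities.Theorems.PurelyInseparableDim4PhiLineLabelPropagation
import HarnessLib

/-!
# (K-Φ2) chain dictionary X: THE `u`-FREE PART OF THE CHILD'S INITIAL FORM is `ε₀ · Ψ(Y)` — the label form is CONSTANT along the line

Cell `res-dim4-pi` (D-0157 DOOR 2), Φ = β_h line of res-dim4-idea-1 (CARD I-1-8 (P2), residue (R1) of idea-1 g7). (K-Φ2) IX `exists_label_readaptation`
takes as input the non-degeneracy of the `u`-free part of `in_d (σ_B G′)` (the child residual in frame coordinates). This file computes that part from the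
step's residual decomposition ((K-Φ2) II `step_F_eq_monomial_mul_residual`: `G′ = ε·H₀ + R`, `ε(0) ≠ 0`, `R ∈ (x_h^e)` with `e ≥ d`; (K-Φ2) VII
`chartTransform_translate_label`: `H₀ = Ψ(ℓ′) + x_j·Q′`, `x_j ∈ {u₁, u₂}` the chart letter) and proves (DEF-FREE):

* §1 `linSubst_frameForm_eq_X`, `linSubst_X_eq_X_of_row_eq_single` — in frame coordinates the frame forms ARE the variables (`σ_B ℓ′_k = Y_k`,
  `σ_B x_j = X_u` when row `u` of `A` is `e_j`); coefficient vanishing `killVars_homogeneousComponent_X_mul`, `…_of_mem_span_X_pow`;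
* §2 **`killVars_homogeneousComponent_linSubst_eq`**: `(in_d (σ_B G′))(Y, 0, 0) = C ε(0) · Ψ(Y₀, Y₁)`;
* §3 **`uFree_nondegenerate`**: if `A(Ψ) = 0` (the binary label form is non-degenerate — `e = 2` at the START of the line, a constant of the line) then
  IX's hypothesis `hF′` holds at the child; **`exists_label_readaptation_of_step`** = IX with `hF′` discharged.

[OURS · counted 0 · AI work weaker than expert review.] Nothing here proves K2(p), the β_h line, or resolution of singularities in dimension ≥ 4 /
characteristic p.

Sources: V. Cossart, U. Jannsen, S. Saito (2020) Lemma 12.2, Setup B (9.6)–(9.7) [`CossartJannsenSaito2020`]; V. Cossart, O. Piltant, J. Algebra 320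
(2008) Prop. 4.2 [`CossartPiltant2008`].
-/

set_option linter.dupNamespace false

noncomputable section

namespace Summit.ResolutionOfSingularities.ResolutionOfSingularities.Theorems.PIDim4

namespace PhiLine

open MvPolynomial Finset IsLocalRing
open Literature.AlgebraicGeometry.Resolution
open Literature.AlgebraicGeometry.Resolution.Hauser2010
open Literature.AlgebraicGeometry.Resolution.WeightedOrder
open Literature.AlgebraicGeometry.Resolution.PointBlowup (additiveSubspace killVars)

variable {K : Type} [Field K]

/-! ## §1 Frame forms in frame coordinates; two coefficient-vanishing lemmas -/

/-- `σ_B (Σ_t A i t · x_t) = X_i` when `A B = 1`. [cite: CossartPiltant2008, proof of Prop. 4.2] -/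
theorem linSubst_frameForm_eq_X {A B : Matrix (Fin 4) (Fin 4) K} (hAB : A * B = 1) (i : Fin 4) :
    linSubst K B (∑ t, C (A i t) * X t) = X i := by
  rw [← linSubst_X, linSubst_linSubst_of_mul_eq_one hAB]

/-- `σ_B x_j = X_u` when row `u` of `A` is `e_j` and `A B = 1`. [cite: CossartPiltant2008, proof of Prop. 4.2] -/
theorem linSubst_X_eq_X_of_row_eq_single {A B : Matrix (Fin 4) (Fin 4) K} (hAB : A * B = 1) {u j : Fin 4} (hAu : A u = Pi.single j 1) :
    linSubst K B (X j) = X u := by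
  rw [← linSubst_frameForm_eq_X hAB u, hAu, sum_C_single_mul_X]

/-- A multiple of `X_u` (`u ∈ U`) has no `U`-free monomial in any homogeneous component. [folklore] -/
theorem killVars_homogeneousComponent_X_mul (U : Finset (Fin 4)) {u : Fin 4} (hu : u ∈ U) (F : MvPolynomial (Fin 4) K) (n : ℕ) :
    killVars U (homogeneousComponent n (X u * F)) = 0 := by
  classical
  rw [killVars_eq_zero_iff_forall_coeff]
  intro β hβ
  rw [coeff_homogeneousComponent]
  split_ifs
  · rw [coeff_X_mul', if_neg (by rw [Finsupp.mem_support_iff, not_not]; exact hβ u hu)]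
  · rfl

/-- An element of `(X_u^e)` with `u ∈ U`, `1 ≤ e`, has no `U`-free monomial in any homogeneous component. [folklore] -/
theorem killVars_homogeneousComponent_of_mem_span_X_pow (U : Finset (Fin 4)) {u : Fin 4} (hu : u ∈ U) {e : ℕ} (he : 1 ≤ e)
    {F : MvPolynomial (Fin 4) K} (hF : F ∈ Ideal.span {(X u : MvPolynomial (Fin 4) K) ^ e}) (n : ℕ) :
    killVars U (homogeneousComponent n F) = 0 := by
  obtain ⟨S, rfl⟩ := Ideal.mem_span_singleton'.mp hF
  obtain ⟨e', rfl⟩ := Nat.exists_eq_add_of_le he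
  rw [show S * X u ^ (1 + e') = X u * (X u ^ e' * S) by ring]
  exact killVars_homogeneousComponent_X_mul U hu _ n

/-- A polynomial of order `≥ n + 1` has zero degree-`n` component. [folklore] -/
theorem homogeneousComponent_eq_zero_of_mem_originIdeal_pow {F : MvPolynomial (Fin 4) K} {n : ℕ}
    (hF : F ∈ Literature.AlgebraicGeometry.Resolution.originIdeal K 4 ^ (n + 1)) : homogeneousComponent n F = 0 := by
  rw [originIdeal_eq_idealOfVars, mem_pow_idealOfVars_iff] at hF
  exact homogeneousComponent_eq_zero' _ _ fun m hm => by have := hF m hm; omega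

/-! ## §2 The `u`-free part of `in_d (σ_B G′)` -/

/-- **`(in_d (σ_B G′))(Y, 0, 0) = ε(0)·Ψ(Y)`.** With `G′ = ε·H₀ + R` (`ε(0) ≠ 0`, `R ∈ (x_h^e)`, `d ≤ e`, `1 ≤ d`, `ord₀ G′ ≥ d`),
`H₀ = Ψ(ℓ′) + x_j Q′` (`Ψ` a binary form of degree `d` in the `y′`-rows of the frame `A`), row `u` of `A` equal to `e_j` (`u ∈ {u₁, u₂}`) and
row `u₁` equal to `e_h`: in frame coordinates `σ_B H₀ = Ψ(Y₀,Y₁) + X_u σ_B Q′`, `σ_B R ∈ (X_{u₁}^e)`, `ord₀ σ_B H₀ ≥ d`, so the `u`-free part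
of the degree-`d` component of `σ_B G′` is `ε(0)·Ψ(Y)`. [cite: CossartJannsenSaito2020, Lemma 12.2] [cite: CossartJannsenSaito2020, Setup B (9.7)] -/
theorem killVars_homogeneousComponent_linSubst_eq {A B : Matrix (Fin 4) (Fin 4) K} (hAB : A * B = 1) {u : Fin (2 + 2)}
    (hu : u ∈ ({u1 2, u2 2} : Finset (Fin (2 + 2)))) {j h : Fin 4} (hAu : A u = Pi.single j 1) (hAu1 : A (u1 2) = Pi.single h 1)
    {G' ε H₀ R Q' : MvPolynomial (Fin 4) K} {Ψ : MvPolynomial (Fin 2) K} {d e : ℕ} (hd1 : 1 ≤ d) (hde : d ≤ e)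
    (hG' : G' = ε * H₀ + R) (hdG : (d : ℕ∞) ≤ ordZero G') (hε : constantCoeff ε ≠ 0)
    (hR : R ∈ Ideal.span {(X h : MvPolynomial (Fin 4) K) ^ e})
    (hH₀ : H₀ = aeval (fun k : Fin 2 => ∑ t, C (A (Fin.castAdd 2 k) t) * X t) Ψ + X j * Q') (hΨ : Ψ.IsHomogeneous d) :
    killVars ({u1 2, u2 2} : Finset (Fin (2 + 2))) (homogeneousComponent d (linSubst K B G')) =
      C (constantCoeff ε) * rename (Fin.castAdd 2) Ψ := by
  classical
  set U : Finset (Fin (2 + 2)) := {u1 2, u2 2} with hU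
  have hu1U : u1 2 ∈ U := by rw [hU]; exact Finset.mem_insert_self _ _
  -- `ord₀ H₀ ≥ d`
  have hRd : R ∈ Ideal.span {(X h : MvPolynomial (Fin 4) K) ^ d} := by
    obtain ⟨S, rfl⟩ := Ideal.mem_span_singleton'.mp hR
    obtain ⟨e', rfl⟩ := Nat.exists_eq_add_of_le hde
    exact Ideal.mem_span_singleton'.mpr ⟨S * X h ^ e', by ring⟩
  have hH₀d : (d : ℕ∞) ≤ ordZero H₀ := le_ordZero_of_eq_unit_mul_add hG' hdG hε hRd
  -- frame coordinates
  have hcompA : (linSubst K B).comp (aeval fun k : Fin 2 => (∑ t, C (A (Fin.castAdd 2 k) t) * X t : MvPolynomial (Fin 4) K)) =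
      rename (Fin.castAdd 2) :=
    MvPolynomial.algHom_ext fun k => by rw [AlgHom.comp_apply, aeval_X, linSubst_frameForm_eq_X hAB, rename_X]
  have hσH₀ : linSubst K B H₀ = rename (Fin.castAdd 2) Ψ + X u * linSubst K B Q' := by
    rw [hH₀, map_add, map_mul, linSubst_X_eq_X_of_row_eq_single hAB hAu, ← AlgHom.comp_apply, hcompA]
  have hσR : linSubst K B R ∈ Ideal.span {(X (u1 2) : MvPolynomial (Fin 4) K) ^ e} := by
    obtain ⟨S, rfl⟩ := Ideal.mem_span_singleton'.mp hR
    rw [map_mul, map_pow, linSubst_X_eq_X_of_row_eq_single hAB hAu1]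
    exact Ideal.mem_span_singleton'.mpr ⟨linSubst K B S, rfl⟩
  have hσH₀mem : linSubst K B H₀ ∈ Literature.AlgebraicGeometry.Resolution.originIdeal K 4 ^ d := by
    rw [originIdeal_eq_idealOfVars, ← natCast_le_ordZero_iff_mem_idealOfVars_pow]
    exact natCast_le_ordZero_linSubst B hH₀d
  -- split off the unit's constant: `σ_B G′ = C ε₀ · σ_B H₀ + (σ_B ε − C ε₀) · σ_B H₀ + σ_B R`
  have hsplit : linSubst K B G' = C (constantCoeff ε) * linSubst K B H₀ +
      ((linSubst K B ε - C (constantCoeff ε)) * linSubst K B H₀ + linSubst K B R) := by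
    rw [hG', map_add, map_mul]; ring
  have hmid : (linSubst K B ε - C (constantCoeff ε)) * linSubst K B H₀ ∈
      Literature.AlgebraicGeometry.Resolution.originIdeal K 4 ^ (d + 1) := by
    rw [pow_succ']
    refine Ideal.mul_mem_mul ?_ hσH₀mem
    rw [originIdeal_eq_idealOfVars, ← one_le_ordZero_iff_mem_idealOfVars, one_le_ordZero_iff, map_sub, constantCoeff_C,
      constantCoeff_linSubst, sub_self]
  -- degree-`d` components and `u`-free parts
  have hcomp : homogeneousComponent d (linSubst K B G') =
      C (constantCoeff ε) * homogeneousComponent d (linSubst K B H₀) + homogeneousComponent d (linSubst K B R) := by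
    rw [hsplit, map_add, map_add, homogeneousComponent_C_mul, homogeneousComponent_eq_zero_of_mem_originIdeal_pow hmid, zero_add]
  have hC : killVars U (C (constantCoeff ε)) = C (constantCoeff ε) := by rw [killVars, aeval_C, algebraMap_eq]
  have hΨ4 : killVars U (rename (Fin.castAdd 2) Ψ) = rename (Fin.castAdd 2) Ψ := by
    rw [← AlgHom.comp_apply]
    refine AlgHom.congr_fun (MvPolynomial.algHom_ext fun k => ?_) Ψ
    have hk : Fin.castAdd 2 k ∉ U := by
      rw [hU, Finset.mem_insert, Finset.mem_singleton, not_or]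
      exact ⟨castAdd_ne_u1 k, castAdd_ne_u2 k⟩
    rw [AlgHom.comp_apply, rename_X, killVars, aeval_X, if_neg hk]
  rw [hcomp, map_add, map_mul, killVars_homogeneousComponent_of_mem_span_X_pow U hu1U (le_trans hd1 hde) hσR, add_zero, hσH₀, map_add,
    map_add, killVars_homogeneousComponent_X_mul U hu, add_zero, homogeneousComponent_eq_self hΨ.rename_isHomogeneous, hC, hΨ4]

/-! ## §3 Non-degeneracy of the `u`-free part and the discharged label propagation -/

/-- **`A(Ψ) = 0` ⇒ IX's `hF′` at the child.** If the binary label form `Ψ` is non-degenerate (`∀ w ∈ A(Ψ), w = 0`), then every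
`v ∈ A((in_d σ_B G′)(Y,0,0))` with `v_{u₁} = v_{u₂} = 0` vanishes. [cite: CossartJannsenSaito2020, Lemma 12.2] -/
theorem uFree_nondegenerate {A B : Matrix (Fin 4) (Fin 4) K} (hAB : A * B = 1) {u : Fin (2 + 2)}
    (hu : u ∈ ({u1 2, u2 2} : Finset (Fin (2 + 2)))) {j h : Fin 4} (hAu : A u = Pi.single j 1) (hAu1 : A (u1 2) = Pi.single h 1)
    {G' ε H₀ R Q' : MvPolynomial (Fin 4) K} {Ψ : MvPolynomial (Fin 2) K} {d e : ℕ} (hd1 : 1 ≤ d) (hde : d ≤ e)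
    (hG' : G' = ε * H₀ + R) (hdG : (d : ℕ∞) ≤ ordZero G') (hε : constantCoeff ε ≠ 0)
    (hR : R ∈ Ideal.span {(X h : MvPolynomial (Fin 4) K) ^ e})
    (hH₀ : H₀ = aeval (fun k : Fin 2 => ∑ t, C (A (Fin.castAdd 2 k) t) * X t) Ψ + X j * Q') (hΨ : Ψ.IsHomogeneous d)
    (hΨA : ∀ w ∈ additiveSubspace Ψ, w = 0) :
    ∀ v ∈ additiveSubspace (killVars ({u1 2, u2 2} : Finset (Fin (2 + 2))) (homogeneousComponent d (linSubst K B G'))),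
      (∀ i ∈ ({u1 2, u2 2} : Finset (Fin (2 + 2))), v i = 0) → v = 0 := by
  classical
  intro v hv hvU
  have hv1 : v (u1 2) = 0 := hvU _ (Finset.mem_insert_self _ _)
  have hv2 : v (u2 2) = 0 := hvU _ (Finset.mem_insert_of_mem (Finset.mem_singleton_self _))
  rw [killVars_homogeneousComponent_linSubst_eq hAB hu hAu hAu1 hd1 hde hG' hdG hε hR hH₀ hΨ, mem_additiveSubspace_iff_sum_smul_pderiv] at hv
  simp_rw [pderiv_C_mul, ← mul_smul_comm, ← Finset.mul_sum] at hv
  rw [mul_eq_zero, C_eq_zero, or_iff_right hε, Fin.sum_univ_add] at hv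
  simp only [Fin.sum_univ_two] at hv
  change v (Fin.castAdd 2 0) • pderiv (Fin.castAdd 2 0) (rename (Fin.castAdd 2) Ψ) +
      v (Fin.castAdd 2 1) • pderiv (Fin.castAdd 2 1) (rename (Fin.castAdd 2) Ψ) +
    (v (u1 2) • pderiv (u1 2) (rename (Fin.castAdd 2) Ψ) + v (u2 2) • pderiv (u2 2) (rename (Fin.castAdd 2) Ψ)) = 0 at hv
  rw [hv1, hv2, zero_smul, zero_smul, add_zero, add_zero] at hv
  -- `hv : v_{y₀} ∂_{Y₀} Ψ₄ + v_{y₁} ∂_{Y₁} Ψ₄ = 0`; pull back along the injective `rename (castAdd 2)`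
  have hw : (fun k : Fin 2 => v (Fin.castAdd 2 k)) ∈ additiveSubspace Ψ := by
    rw [mem_additiveSubspace_iff_sum_smul_pderiv, Fin.sum_univ_two, smul_eq_C_mul, smul_eq_C_mul]
    apply rename_injective _ (Fin.castAdd_injective 2 2)
    rw [map_zero, map_add, map_mul, map_mul, rename_C, rename_C, ← pderiv_rename (Fin.castAdd_injective 2 2),
      ← pderiv_rename (Fin.castAdd_injective 2 2), ← smul_eq_C_mul, ← smul_eq_C_mul]
    exact hv
  have hw0 := hΨA _ hw
  funext i
  induction i using Fin.addCases with
  | left k => exact congrFun hw0 k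
  | right k =>
    fin_cases k
    · exact hv1
    · exact hv2

/-- **LABEL PROPAGATION with the `u`-free input discharged**: (K-Φ2) IX `exists_label_readaptation` for a child residual `G′ = ε·H₀ + R`,
`H₀ = Ψ(ℓ′) + x_j Q′` as delivered by (K-Φ2) II/VII, assuming only that the binary label form `Ψ` is non-degenerate (`A(Ψ) = 0`), that the
child is again an `e ≥ 2` point (`dim A(in_d G′) ≥ 2`), and `0 < αs < d!`, `pts ≠ ∅` in the carried frame.
[cite: CossartJannsenSaito2020, Lemma 12.2, Def. 8.2 (3), Def. 8.4, Thm. 8.16] [cite: CossartPiltant2008, Prop. 4.2] -/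
theorem exists_label_readaptation_of_step (p : ℕ) [CharP K p] {d : ℕ} (hdp : d < p) {A B : Matrix (Fin 4) (Fin 4) K} (hAB : A * B = 1)
    (hBA : B * A = 1) {u : Fin (2 + 2)} (hu : u ∈ ({u1 2, u2 2} : Finset (Fin (2 + 2)))) {j h : Fin 4} (hAu : A u = Pi.single j 1)
    (hAu1 : A (u1 2) = Pi.single h 1) {G' ε H₀ R Q' : MvPolynomial (Fin 4) K} {Ψ : MvPolynomial (Fin 2) K} {e : ℕ} (hd1 : 1 ≤ d)
    (hde : d ≤ e) (hG' : G' = ε * H₀ + R) (hdG : (d : ℕ∞) ≤ ordZero G') (hε : constantCoeff ε ≠ 0)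
    (hR : R ∈ Ideal.span {(X h : MvPolynomial (Fin 4) K) ^ e})
    (hH₀ : H₀ = aeval (fun k : Fin 2 => ∑ t, C (A (Fin.castAdd 2 k) t) * X t) Ψ + X j * Q') (hΨ : Ψ.IsHomogeneous d)
    (hΨA : ∀ w ∈ additiveSubspace Ψ, w = 0)
    (hT : 2 ≤ Module.finrank K (additiveSubspace (homogeneousComponent d G')))
    (hne : (pts (fun i : Fin (2 + 2) => algebraMap (MvPolynomial (Fin 4) K) (OriginLocalization K 4) (∑ t, C (A i t) * X t))
      (Ideal.span {algebraMap (MvPolynomial (Fin 4) K) (OriginLocalization K 4) G'}) d).Nonempty)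
    (hα0 : 0 < alphaS (fun i : Fin (2 + 2) => algebraMap (MvPolynomial (Fin 4) K) (OriginLocalization K 4) (∑ t, C (A i t) * X t))
      (Ideal.span {algebraMap (MvPolynomial (Fin 4) K) (OriginLocalization K 4) G'}) d)
    (hα1 : alphaS (fun i : Fin (2 + 2) => algebraMap (MvPolynomial (Fin 4) K) (OriginLocalization K 4) (∑ t, C (A i t) * X t))
      (Ideal.span {algebraMap (MvPolynomial (Fin 4) K) (OriginLocalization K 4) G'}) d < d.factorial) :
    ∃ lam : Fin 2 → K, ∃ A' B' : Matrix (Fin 4) (Fin 4) K, A' * B' = 1 ∧ B' * A' = 1 ∧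
      (∀ k : Fin 2, A' (Fin.castAdd 2 k) = A (Fin.castAdd 2 k) + lam k • A (u1 2)) ∧ A' (u1 2) = A (u1 2) ∧ A' (u2 2) = A (u2 2) ∧
      (pts (fun i : Fin (2 + 2) => algebraMap (MvPolynomial (Fin 4) K) (OriginLocalization K 4) (∑ t, C (A' i t) * X t))
        (Ideal.span {algebraMap (MvPolynomial (Fin 4) K) (OriginLocalization K 4) G'}) d).Nonempty ∧
      d.factorial < deltaS (fun i : Fin (2 + 2) => algebraMap (MvPolynomial (Fin 4) K) (OriginLocalization K 4) (∑ t, C (A' i t) * X t))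
        (Ideal.span {algebraMap (MvPolynomial (Fin 4) K) (OriginLocalization K 4) G'}) d ∧
      alphaS (fun i : Fin (2 + 2) => algebraMap (MvPolynomial (Fin 4) K) (OriginLocalization K 4) (∑ t, C (A' i t) * X t))
          (Ideal.span {algebraMap (MvPolynomial (Fin 4) K) (OriginLocalization K 4) G'}) d =
        alphaS (fun i : Fin (2 + 2) => algebraMap (MvPolynomial (Fin 4) K) (OriginLocalization K 4) (∑ t, C (A i t) * X t))
          (Ideal.span {algebraMap (MvPolynomial (Fin 4) K) (OriginLocalization K 4) G'}) d ∧
      betaS (fun i : Fin (2 + 2) => algebraMap (MvPolynomial (Fin 4) K) (OriginLocalization K 4) (∑ t, C (A' i t) * X t))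
          (Ideal.span {algebraMap (MvPolynomial (Fin 4) K) (OriginLocalization K 4) G'}) d =
        betaS (fun i : Fin (2 + 2) => algebraMap (MvPolynomial (Fin 4) K) (OriginLocalization K 4) (∑ t, C (A i t) * X t))
          (Ideal.span {algebraMap (MvPolynomial (Fin 4) K) (OriginLocalization K 4) G'}) d :=
  exists_label_readaptation p hdp hAB hBA hdG hT (uFree_nondegenerate hAB hu hAu hAu1 hd1 hde hG' hdG hε hR hH₀ hΨ hΨA) hne hα0 hα1

end PhiLine

end Summit.ResolutionOfSingularities.ResolutionOfSingularities.Theorems.PIDim4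

end
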